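/-
Copyright: the b2b-balaban T⁴-continuum CRUX team, row NE7b OWNER lineage `t4-ne7b-p1` (gen 118). Project licence.
-/
import Mathlib.LinearAlgebra.Dual.Lemmas
import Mathlib.LinearAlgebra.FiniteDimensional.Lemmas
import Summits.QuantumFields.BalabanUV.T4Continuum.Spine.NE7b.SupConvexStepSemigroup

/-!
# THE SECOND-ORDER CLASS IS ALSO CLOSED UNDER THE CONVEX BLOCK-SPIN STEP: if, on top of (110)'s first-order class, `S′` is
# differentiable everywhere with a Hessian floor `m·Σ h² ≤ S″(φ) h h`, then for ANY block map with a right inverse and block Jensen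
# constant `vol` the fibre-critical map `Φ` is DIFFERENTIABLE at every block field (derivative = the abstract fibre response, an
# implicit-function theorem from the floor alone), the gradient `W′ = (S′∘Φ)∘M` of the fibre minimum has the derivative
# `W″(w) = S″(Φ w)(D w –, D w –)` at every `w`, and `W″` KEEPS THE FLOOR with modulus `m·vol` — so the Hessian-floor theory of
# (101)∕(102) ITERATES along any tower of block maps: after `k` steps the effective action is twice differentiable with floor `m·Π vol`
# (row NE7b, node U5c; (110) + HSAH BY NAME; [folklore])

Cell `pub-balaban`, sub-cell `t4`, spine estimate NE7b (`T4WeightBudget.RelWeightBound`; the cell's OWN estimate — NOT PRINTED in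
[Bałaban 1983–89], NOT PROVED).  Crux-route work under `Spine/NE7b/` by the row OWNER (`t4-ne7b-p1` gen 118) under FREEZE (0)'s
crux-prover clause; NOTHING of Bałaban's is named as a Lean object, valued or asserted; no `T4Continuum/Support` leaf typed; no `def`,
no notation; zero `sorry`.  Imports (BY NAME): the OWNER's (110) `…SupConvexStepSemigroup` (`isMinOn_of_critical`,
`existsUnique_fibreCritical`, `hasFDerivAt_fibreMin`, `fibreMin_firstOrder`; through it (93) `norm_sq_le_sum_sq`, HSAH
`hasFDerivAt_fderiv_comp_branch`); Mathlib's dual-space dimension count for the coercive solve (as in (98)).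

WHY (located).  (101)∕(102)∕(107) are typed for the sitewise action; what their proofs use of it is: `S′` differentiable at the
background with a positive floor for `S″` there (the implicit-function argument of (101) is a floor argument on the fibre remainder),
and HSAH's graph formula.  Both are statements about the abstract triple `(S, S′, S″)`, so the second-order class
`{HasFDerivAt S (S′ φ) φ, HasFDerivAt S′ (S″ φ) φ, first-order letter m, floor m}` is closed under the step with `m ↦ m·vol` —
the abstract response exists by the coercive solve on `ker Qt` ((98)'s argument for a general bilinear form).

WHAT IS PROVED ([folklore]):
* §1 `existsUnique_coercive_solution` (a bilinear form with floor `m > 0` restricted to ANY submodule `K` of a finite carrier solves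
  `H h κ = g κ (κ ∈ K)` uniquely in `K`), **`exists_response`** (`∃ D` continuous linear: `Qt(D k) = k`, `H (D k) κ = 0` on `ker Qt`).
* §2 (the class) **`continuousAt_fibreCritical`**, **`hasFDerivAt_fibreCritical`** (ANY `D` with the two letters at `Φ w` for
  `S″(Φ w)` IS the derivative), **`exists_hasFDerivAt_fibreCritical`**.
* §3 **`hasFDerivAt_gradient_fibreMin`** (`HasFDerivAt (w ↦ (S′(Φ w))∘M) ((S″(Φ w)).bilinearComp (D w) (D w)) w`),
  `hessian_fibreMin_floor_response` ∕ **`hessian_fibreMin_floor`** (`m·Σ(D w k)² ≤ W″ k k`, `m·vol·Σ k² ≤ W″ k k`),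
  **`step_closure₂`** (assembled: the step maps the second-order class `(ι, m)` into `(κ, m·vol)`).
* §4 toy.  (The torus instance — the sitewise action is in the class with `m = min(2,a) − λ` — and the two-step tower are the
  sequel `…SupConvexStepTorusTower`.)

HONEST (what this is NOT).  Abstract finite-dimensional calculus; continuity of `w ↦ W″(w)` (the `C²` CLASS, (107)) needs a modulus
for `φ ↦ S″(φ)` which the class does not carry and is not claimed; no locality; constants `m·Π vol` only; nothing about the measure;
cubic periods; scalar skeleton, hard constraint ((A3), NC-NE7b-α UNRULED); nothing of Bałaban's.  BY-NAME EFFECT ON THE WALL: NONE.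
NE7b NOT PRINTED ∕ NOT PROVED; spine PROVED 0∕9; rung (B)+1 on a FINITE torus — NOT infinite volume, NOT the mass gap, NOT Clay.  HONEST
DEPENDENCY: continuum YM on T⁴ ⇐ BetaPertH ∧ nine spine estimates (0∕9 proved); BetaPertH ⇐ (D1) ∧ (D4) ∧ CAP+tail; G-an2-4 gates asym,
D1 and NE2∕3∕4.
-/

set_option autoImplicit false

noncomputable section

namespace Summit.QuantumFields.BalabanUV.T4Continuum.NE7b.SupConvexStepHessian

open Set Function Filter Asymptotics Metric Module
open scoped ENNReal Topology
open HardStepActionHessian (hasFDerivAt_fderiv_comp_branch)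
open SupTorusActionMinimiser (norm_sq_le_sum_sq)
open SupConvexStepSemigroup (isMinOn_of_critical existsUnique_fibreCritical hasFDerivAt_fibreMin fibreMin_firstOrder)

/-! ## §1. The coercive solve on a submodule; the abstract response -/

section Response

variable {ι κ : Type*} [Fintype ι] [Fintype κ]

omit [Fintype κ] in
/-- **A COERCIVE FORM SOLVES UNIQUELY ON ANY SUBMODULE** (finite carrier): `m·Σ h² ≤ H h h`, `m > 0` ⟹ for every covector `g` and
submodule `K` there is exactly one `h ∈ K` with `H h κ = g κ` for all `κ ∈ K`. [folklore] -/
theorem existsUnique_coercive_solution {H : (ι → ℝ) →L[ℝ] (ι → ℝ) →L[ℝ] ℝ} {m : ℝ} (hm : 0 < m)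
    (hfl : ∀ h : ι → ℝ, m * ∑ x, h x ^ 2 ≤ H h h) (K : Submodule ℝ (ι → ℝ)) (g : (ι → ℝ) →L[ℝ] ℝ) :
    ∃! h : ι → ℝ, h ∈ K ∧ ∀ κ' ∈ K, H h κ' = g κ' := by
  classical
  let T : K →ₗ[ℝ] Module.Dual ℝ K :=
    { toFun := fun h => (H (h : ι → ℝ)).toLinearMap ∘ₗ K.subtype
      map_add' := fun h h' => by
        ext κ'
        simp only [Submodule.coe_add, map_add, LinearMap.coe_comp, Function.comp_apply, Submodule.coe_subtype,
          ContinuousLinearMap.coe_coe, add_apply, LinearMap.add_apply]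
      map_smul' := fun c h => by
        ext κ'
        simp only [Submodule.coe_smul, map_smul, LinearMap.coe_comp, Function.comp_apply, Submodule.coe_subtype,
          ContinuousLinearMap.coe_coe, smul_apply, RingHom.id_apply, LinearMap.smul_apply] }
  have hT : ∀ (h κ' : K), T h κ' = H (h : ι → ℝ) (κ' : ι → ℝ) := fun h κ' => by
    simp only [T, LinearMap.coe_mk, AddHom.coe_mk, LinearMap.coe_comp, Function.comp_apply, Submodule.coe_subtype,
      ContinuousLinearMap.coe_coe]
  -- injective by the floor
  have hinj : Function.Injective T := by
    refine (injective_iff_map_eq_zero T).2 fun h hTh => ?_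
    have h0 : H (h : ι → ℝ) (h : ι → ℝ) = 0 := by
      have := congrArg (fun L : Module.Dual ℝ K => L h) hTh
      simpa only [hT, LinearMap.zero_apply] using this
    have hsum : ∑ x, (h : ι → ℝ) x ^ 2 = 0 := by
      have h1 := hfl (h : ι → ℝ)
      rw [h0] at h1
      exact le_antisymm (nonpos_of_mul_nonpos_right h1 hm) (Finset.sum_nonneg fun x _ => sq_nonneg _)
    refine Subtype.ext (funext fun x => ?_)
    have hx := (Finset.sum_eq_zero_iff_of_nonneg fun y _ => sq_nonneg ((h : ι → ℝ) y)).1 hsum x (Finset.mem_univ x)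
    exact pow_eq_zero_iff two_ne_zero |>.1 hx
  have hsurj : Function.Surjective T :=
    (LinearMap.injective_iff_surjective_of_finrank_eq_finrank (Subspace.dual_finrank_eq).symm).1 hinj
  obtain ⟨h, hh⟩ := hsurj (g.toLinearMap ∘ₗ K.subtype)
  refine ⟨(h : ι → ℝ), ⟨h.2, fun κ' hκ' => ?_⟩, fun h' hh' => ?_⟩
  · have := congrArg (fun F : Module.Dual ℝ K => F ⟨κ', hκ'⟩) hh
    simpa only [hT, LinearMap.coe_comp, Function.comp_apply, Submodule.coe_subtype, ContinuousLinearMap.coe_coe] using this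
  · have hTh' : T ⟨h', hh'.1⟩ = g.toLinearMap ∘ₗ K.subtype := by
      ext κ'
      simp only [hT, LinearMap.coe_comp, Function.comp_apply, Submodule.coe_subtype, ContinuousLinearMap.coe_coe]
      exact hh'.2 κ' κ'.2
    have := hinj (hTh'.trans hh.symm)
    exact congrArg Subtype.val this

/-- **THE ABSTRACT RESPONSE EXISTS**: a form `H` with floor `m > 0`, ANY `Qt` with a continuous linear right inverse `M` ⟹ `∃ D`
continuous linear with `Qt (D k) = k` and `H (D k) κ = 0` for all `κ ∈ ker Qt`. [folklore] -/
theorem exists_response {H : (ι → ℝ) →L[ℝ] (ι → ℝ) →L[ℝ] ℝ} {m : ℝ} (hm : 0 < m)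
    (hfl : ∀ h : ι → ℝ, m * ∑ x, h x ^ 2 ≤ H h h) (Qt : (ι → ℝ) →L[ℝ] (κ → ℝ)) (M : (κ → ℝ) →L[ℝ] (ι → ℝ))
    (hM : ∀ k : κ → ℝ, Qt (M k) = k) :
    ∃ D : (κ → ℝ) →L[ℝ] (ι → ℝ), (∀ k : κ → ℝ, Qt (D k) = k) ∧
      ∀ (k : κ → ℝ) (κ' : ι → ℝ), Qt κ' = 0 → H (D k) κ' = 0 := by
  have hmem : ∀ κ' : ι → ℝ, Qt κ' = 0 ↔ κ' ∈ LinearMap.ker Qt.toLinearMap := fun κ' => by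
    rw [LinearMap.mem_ker, ContinuousLinearMap.coe_coe]
  -- the correction of the block lift: `h ∈ ker Qt`, `H (M k + h) κ = 0` on `ker Qt`
  have hsol : ∀ k : κ → ℝ, ∃! h : ι → ℝ, Qt h = 0 ∧ ∀ κ' : ι → ℝ, Qt κ' = 0 → H (M k + h) κ' = 0 := by
    intro k
    obtain ⟨h, ⟨hker, hsolves⟩, huniq⟩ := existsUnique_coercive_solution hm hfl (LinearMap.ker Qt.toLinearMap) (-(H (M k)))
    refine ⟨h, ⟨(hmem h).2 hker, fun κ' hκ' => ?_⟩, fun h' hh' => huniq h' ⟨(hmem h').1 hh'.1, fun κ' hκ' => ?_⟩⟩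
    · rw [map_add, add_apply, hsolves κ' ((hmem κ').1 hκ'), neg_apply]; ring
    · have := hh'.2 κ' ((hmem κ').2 hκ')
      rw [map_add, add_apply] at this
      rw [neg_apply]; linarith
  choose h hh using hsol
  have hadd : ∀ k k' : κ → ℝ, h (k + k') = h k + h k' := fun k k' => by
    refine ((hh (k + k')).2 (h k + h k') ⟨?_, fun κ' hκ' => ?_⟩).symm
    · rw [map_add, (hh k).1.1, (hh k').1.1, add_zero]
    · have e : M (k + k') + (h k + h k') = (M k + h k) + (M k' + h k') := by rw [map_add]; abel
      rw [e, map_add, add_apply, (hh k).1.2 κ' hκ', (hh k').1.2 κ' hκ', add_zero]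
  have hsmul : ∀ (c : ℝ) (k : κ → ℝ), h (c • k) = c • h k := fun c k => by
    refine ((hh (c • k)).2 (c • h k) ⟨?_, fun κ' hκ' => ?_⟩).symm
    · rw [map_smul, (hh k).1.1, smul_zero]
    · have e : M (c • k) + c • h k = c • (M k + h k) := by rw [map_smul, smul_add]
      rw [e, map_smul, smul_apply, (hh k).1.2 κ' hκ', smul_zero]
  let Dl : (κ → ℝ) →ₗ[ℝ] (ι → ℝ) :=
    { toFun := fun k => M k + h k
      map_add' := fun k k' => by
        simp only [map_add, hadd]
        abel
      map_smul' := fun c k => by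
        simp only [map_smul, hsmul, RingHom.id_apply, smul_add] }
  refine ⟨LinearMap.toContinuousLinearMap Dl, fun k => ?_, fun k κ' hκ' => ?_⟩
  · show Qt (M k + h k) = k
    rw [map_add, hM, (hh k).1.1, add_zero]
  · show H (M k + h k) κ' = 0
    exact (hh k).1.2 κ' hκ'

end Response

/-! ## §2. The class: continuity and the implicit-function theorem for the fibre-critical map -/

section IFT

variable {ι κ : Type*} [Fintype ι] [Fintype κ]
  {S : (ι → ℝ) → ℝ} {S' : (ι → ℝ) → (ι → ℝ) →L[ℝ] ℝ} {m : ℝ}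

omit [Fintype κ] in
/-- **THE FIBRE-CRITICAL MAP IS CONTINUOUS** (first-order class, `m > 0`; `Qt` with right inverse `M`; `Φ` with `Qt(Φ w) = w` and
fibre-critical values): from `½m·Σ(Φ w′ − Φ w)² ≤ S(Φ w + M(w′ − w)) − S(Φ w) − S′(Φ w)(M(w′ − w)) → 0`. [folklore] -/
theorem continuousAt_fibreCritical (hS : ∀ φ, HasFDerivAt S (S' φ) φ)
    (hfo : ∀ φ ψ : ι → ℝ, S φ + S' φ (ψ - φ) + m / 2 * ∑ x, (ψ x - φ x) ^ 2 ≤ S ψ) (hm : 0 < m)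
    (Qt : (ι → ℝ) →L[ℝ] (κ → ℝ)) (M : (κ → ℝ) →L[ℝ] (ι → ℝ)) (hM : ∀ k : κ → ℝ, Qt (M k) = k)
    (Φ : (κ → ℝ) → (ι → ℝ)) (hΦQ : ∀ w, Qt (Φ w) = w) (hΦcrit : ∀ (w : κ → ℝ) (h : ι → ℝ), Qt h = 0 → S' (Φ w) h = 0)
    (w : κ → ℝ) : ContinuousAt Φ w := by
  have hScont : Continuous S := continuous_iff_continuousAt.2 fun φ => (hS φ).continuousAt
  have hRcont : Continuous (fun w' : κ → ℝ => S (Φ w + M (w' - w)) - S (Φ w) - S' (Φ w) (M (w' - w))) := by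
    have hshift : Continuous (fun w' : κ → ℝ => Φ w + M (w' - w)) :=
      continuous_const.add (M.continuous.comp (continuous_id.sub continuous_const))
    exact ((hScont.comp hshift).sub continuous_const).sub ((S' (Φ w)).continuous.comp (M.continuous.comp
      (continuous_id.sub continuous_const)))
  have hkey : ∀ w' : κ → ℝ, m / 2 * ∑ x, (Φ w' x - Φ w x) ^ 2
      ≤ S (Φ w + M (w' - w)) - S (Φ w) - S' (Φ w) (M (w' - w)) := by
    intro w'
    have hup : S (Φ w') ≤ S (Φ w + M (w' - w)) := by
      refine isMinOn_iff.1 (isMinOn_of_critical hfo hm.le Qt (hΦcrit w')) (Φ w + M (w' - w)) ?_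
      show Qt (Φ w + M (w' - w)) = Qt (Φ w')
      rw [map_add Qt, hM, hΦQ, hΦQ]; abel
    have h1 := hfo (Φ w) (Φ w')
    have hker : Qt (Φ w' - Φ w - M (w' - w)) = 0 := by rw [map_sub Qt, map_sub Qt, hΦQ, hΦQ, hM]; abel
    have hkill := hΦcrit w _ hker
    rw [map_sub] at hkill
    rw [sub_eq_zero.1 hkill] at h1
    linarith
  rw [ContinuousAt, tendsto_iff_norm_sub_tendsto_zero]
  refine squeeze_zero (fun w' => norm_nonneg _) (fun w' => ?_)
    (g := fun w' : κ → ℝ => Real.sqrt (2 / m * (S (Φ w + M (w' - w)) - S (Φ w) - S' (Φ w) (M (w' - w))))) ?_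
  · rw [← abs_of_nonneg (norm_nonneg (Φ w' - Φ w))]
    refine Real.abs_le_sqrt ?_
    have h1 : ‖Φ w' - Φ w‖ ^ 2 ≤ ∑ x, (Φ w' x - Φ w x) ^ 2 := by
      simpa only [Pi.sub_apply] using norm_sq_le_sum_sq (Φ w' - Φ w)
    have h3 : ∑ x, (Φ w' x - Φ w x) ^ 2 ≤ 2 / m * (S (Φ w + M (w' - w)) - S (Φ w) - S' (Φ w) (M (w' - w))) := by
      have hne : m ≠ 0 := ne_of_gt hm
      have hpos : (0 : ℝ) < 2 / m := by positivity
      calc ∑ x, (Φ w' x - Φ w x) ^ 2 = 2 / m * (m / 2 * ∑ x, (Φ w' x - Φ w x) ^ 2) := by field_simp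
        _ ≤ _ := mul_le_mul_of_nonneg_left (hkey w') hpos.le
    exact h1.trans h3
  · have h0 : Real.sqrt (2 / m * (S (Φ w + M (w - w)) - S (Φ w) - S' (Φ w) (M (w - w)))) = 0 := by
      simp only [sub_self, map_zero, add_zero, Real.sqrt_eq_zero', mul_zero, le_refl]
    rw [← h0]
    exact ((Real.continuous_sqrt.comp (continuous_const.mul hRcont)).tendsto w)

/-- **ANY RESPONSE WITH THE TWO LETTERS IS THE DERIVATIVE OF THE FIBRE-CRITICAL MAP** (first-order class with `m > 0`, and AT THE
ONE POINT `Φ w`: `HasFDerivAt S′ H (Φ w)` with floor `m·Σ h² ≤ H h h`; `Qt (D k) = k`, `H (D k) κ = 0` on `ker Qt`) ⟹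
`HasFDerivAt Φ D w`. [folklore] -/
theorem hasFDerivAt_fibreCritical (hS : ∀ φ, HasFDerivAt S (S' φ) φ)
    (hfo : ∀ φ ψ : ι → ℝ, S φ + S' φ (ψ - φ) + m / 2 * ∑ x, (ψ x - φ x) ^ 2 ≤ S ψ) (hm : 0 < m)
    (Qt : (ι → ℝ) →L[ℝ] (κ → ℝ)) (M : (κ → ℝ) →L[ℝ] (ι → ℝ)) (hM : ∀ k : κ → ℝ, Qt (M k) = k)
    (Φ : (κ → ℝ) → (ι → ℝ)) (hΦQ : ∀ w, Qt (Φ w) = w) (hΦcrit : ∀ (w : κ → ℝ) (h : ι → ℝ), Qt h = 0 → S' (Φ w) h = 0)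
    (w : κ → ℝ) {H : (ι → ℝ) →L[ℝ] (ι → ℝ) →L[ℝ] ℝ} (hS2 : HasFDerivAt S' H (Φ w))
    (hflH : ∀ h : ι → ℝ, m * ∑ x, h x ^ 2 ≤ H h h) {D : (κ → ℝ) →L[ℝ] (ι → ℝ)} (hDQ : ∀ k : κ → ℝ, Qt (D k) = k)
    (hDlin : ∀ (k : κ → ℝ) (κ' : ι → ℝ), Qt κ' = 0 → H (D k) κ' = 0) :
    HasFDerivAt Φ D w := by
  have hcont : ContinuousAt Φ w := continuousAt_fibreCritical hS hfo hm Qt M hM Φ hΦQ hΦcrit w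
  rw [hasFDerivAt_iff_isLittleO_nhds_zero, Asymptotics.isLittleO_iff]
  intro ε hε
  obtain ⟨ε', hε'0, hε'1, hε'2⟩ : ∃ ε' : ℝ, 0 < ε' ∧ ε' ≤ m / 2 ∧ ε' * (2 * ‖D‖) ≤ ε * m := by
    refine ⟨min (m / 2) (ε * m / (2 * ‖D‖ + 1)), lt_min (by positivity) (by positivity), min_le_left _ _, ?_⟩
    have h2D : (0 : ℝ) ≤ 2 * ‖D‖ := by positivity
    calc min (m / 2) (ε * m / (2 * ‖D‖ + 1)) * (2 * ‖D‖)
        ≤ ε * m / (2 * ‖D‖ + 1) * (2 * ‖D‖) := mul_le_mul_of_nonneg_right (min_le_right _ _) h2D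
      _ ≤ ε * m / (2 * ‖D‖ + 1) * (2 * ‖D‖ + 1) := mul_le_mul_of_nonneg_left (by linarith) (by positivity)
      _ = ε * m := div_mul_cancel₀ _ (by positivity)
  have h2 := (hasFDerivAt_iff_isLittleO_nhds_zero.1 hS2)
  rw [Asymptotics.isLittleO_iff] at h2
  have htend : Tendsto (fun k : κ → ℝ => Φ (w + k) - Φ w) (𝓝 0) (𝓝 0) := by
    have h1 : Tendsto (fun k : κ → ℝ => w + k) (𝓝 0) (𝓝 w) :=
      ((continuous_const (y := w)).add continuous_id).tendsto' 0 w (by simp)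
    have h3 : Tendsto (fun k : κ → ℝ => Φ (w + k)) (𝓝 0) (𝓝 (Φ w)) := hcont.tendsto.comp h1
    simpa only [sub_self] using h3.sub (tendsto_const_nhds (x := Φ w))
  refine (htend.eventually (h2 hε'0)).mono fun k hk => ?_
  have hwy : Φ w + (Φ (w + k) - Φ w) = Φ (w + k) := by abel
  rw [hwy] at hk
  set y : ι → ℝ := Φ (w + k) - Φ w with hy
  set r : ι → ℝ := y - D k with hr
  have hQr : Qt r = 0 := by
    rw [hr, hy, map_sub Qt, map_sub Qt, hΦQ, hΦQ, hDQ]; abel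
  have hHr : H r r = -((S' (Φ (w + k)) - S' (Φ w) - H y) r) := by
    rw [sub_apply, sub_apply, hΦcrit (w + k) r hQr, hΦcrit w r hQr]
    have hHD : H (D k) r = 0 := hDlin k r hQr
    have hH1 : H r = H y - H (D k) := by rw [hr, map_sub]
    have : H r r = H y r - H (D k) r := by rw [hH1, sub_apply]
    rw [this, hHD]; ring
  have h3 : m * ‖r‖ ^ 2 ≤ ε' * ‖y‖ * ‖r‖ := by
    calc m * ‖r‖ ^ 2 ≤ m * ∑ x, r x ^ 2 := mul_le_mul_of_nonneg_left (norm_sq_le_sum_sq r) hm.le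
      _ ≤ H r r := hflH r
      _ = _ := hHr
      _ ≤ ‖(S' (Φ (w + k)) - S' (Φ w) - H y) r‖ := by rw [Real.norm_eq_abs]; exact neg_le_abs _
      _ ≤ ‖S' (Φ (w + k)) - S' (Φ w) - H y‖ * ‖r‖ := ContinuousLinearMap.le_opNorm _ r
      _ ≤ ε' * ‖y‖ * ‖r‖ := mul_le_mul_of_nonneg_right hk (norm_nonneg _)
  have h4 : m * ‖r‖ ≤ ε' * ‖y‖ := by
    by_cases h0 : ‖r‖ = 0
    · rw [h0, mul_zero]; positivity
    · have hpos : 0 < ‖r‖ := (norm_nonneg _).lt_of_ne (Ne.symm h0)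
      have : m * ‖r‖ * ‖r‖ ≤ ε' * ‖y‖ * ‖r‖ := by rw [mul_assoc, ← sq]; exact h3
      exact le_of_mul_le_mul_right this hpos
  have h5 : ‖y‖ ≤ 2 * ‖D‖ * ‖k‖ := by
    have hy' : y = D k + r := by rw [hr]; abel
    have h6 : ‖y‖ ≤ ‖D‖ * ‖k‖ + ‖r‖ := by
      rw [hy']; exact (norm_add_le _ _).trans (add_le_add (D.le_opNorm k) le_rfl)
    have h7 : m * ‖r‖ ≤ m / 2 * ‖y‖ := h4.trans (mul_le_mul_of_nonneg_right hε'1 (norm_nonneg _))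
    nlinarith [norm_nonneg r, norm_nonneg y, norm_nonneg k, norm_nonneg D]
  show ‖Φ (w + k) - Φ w - D k‖ ≤ ε * ‖k‖
  have h8 : m * ‖r‖ ≤ m * (ε * ‖k‖) := by
    calc m * ‖r‖ ≤ ε' * ‖y‖ := h4
      _ ≤ ε' * (2 * ‖D‖ * ‖k‖) := mul_le_mul_of_nonneg_left h5 hε'0.le
      _ = ε' * (2 * ‖D‖) * ‖k‖ := by ring
      _ ≤ ε * m * ‖k‖ := mul_le_mul_of_nonneg_right hε'2 (norm_nonneg k)
      _ = m * (ε * ‖k‖) := by ring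
  have h9 : ‖r‖ ≤ ε * ‖k‖ := le_of_mul_le_mul_left h8 hm
  simpa only [hr, hy] using h9

/-- **ASSEMBLED: THE FIBRE-CRITICAL MAP IS DIFFERENTIABLE AT EVERY POINT** (second-order class: `S″` a derivative of `S′` everywhere
with floor `m`): `∃ D`, `Qt (D k) = k`, `S″(Φ w)(D k, κ) = 0` on `ker Qt`, `HasFDerivAt Φ D w`. [folklore] -/
theorem exists_hasFDerivAt_fibreCritical (hS : ∀ φ, HasFDerivAt S (S' φ) φ)
    (hfo : ∀ φ ψ : ι → ℝ, S φ + S' φ (ψ - φ) + m / 2 * ∑ x, (ψ x - φ x) ^ 2 ≤ S ψ) (hm : 0 < m)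
    {S'' : (ι → ℝ) → (ι → ℝ) →L[ℝ] (ι → ℝ) →L[ℝ] ℝ} (hS2 : ∀ φ, HasFDerivAt S' (S'' φ) φ)
    (hfl : ∀ φ h : ι → ℝ, m * ∑ x, h x ^ 2 ≤ S'' φ h h)
    (Qt : (ι → ℝ) →L[ℝ] (κ → ℝ)) (M : (κ → ℝ) →L[ℝ] (ι → ℝ)) (hM : ∀ k : κ → ℝ, Qt (M k) = k)
    (Φ : (κ → ℝ) → (ι → ℝ)) (hΦQ : ∀ w, Qt (Φ w) = w) (hΦcrit : ∀ (w : κ → ℝ) (h : ι → ℝ), Qt h = 0 → S' (Φ w) h = 0)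
    (w : κ → ℝ) :
    ∃ D : (κ → ℝ) →L[ℝ] (ι → ℝ), (∀ k : κ → ℝ, Qt (D k) = k) ∧
      (∀ (k : κ → ℝ) (κ' : ι → ℝ), Qt κ' = 0 → S'' (Φ w) (D k) κ' = 0) ∧ HasFDerivAt Φ D w := by
  obtain ⟨D, hDQ, hDlin⟩ := exists_response hm (hfl (Φ w)) Qt M hM
  exact ⟨D, hDQ, hDlin, hasFDerivAt_fibreCritical hS hfo hm Qt M hM Φ hΦQ hΦcrit w (hS2 (Φ w)) (hfl (Φ w)) hDQ hDlin⟩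

/-! ## §3. The Hessian of the fibre minimum and its floor; closure of the second-order class -/

/-- **THE GRADIENT OF THE FIBRE MINIMUM IS DIFFERENTIABLE: `W″(w) = S″(Φ w)(D w –, D w –)`** (second-order class; `Φ` with a response
family `D` — `Qt(D w k) = k`, `HasFDerivAt Φ (D w′) w′` at every `w′`):
`HasFDerivAt (w ↦ (S′(Φ w))∘M) ((S″(Φ w)).bilinearComp (D w) (D w)) w`. [folklore] -/
theorem hasFDerivAt_gradient_fibreMin (hS : ∀ φ, HasFDerivAt S (S' φ) φ)
    (hfo : ∀ φ ψ : ι → ℝ, S φ + S' φ (ψ - φ) + m / 2 * ∑ x, (ψ x - φ x) ^ 2 ≤ S ψ) (hm : 0 ≤ m)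
    {S'' : (ι → ℝ) → (ι → ℝ) →L[ℝ] (ι → ℝ) →L[ℝ] ℝ} (hS2 : ∀ φ, HasFDerivAt S' (S'' φ) φ)
    (Qt : (ι → ℝ) →L[ℝ] (κ → ℝ)) (M : (κ → ℝ) →L[ℝ] (ι → ℝ)) (hM : ∀ k : κ → ℝ, Qt (M k) = k)
    (Φ : (κ → ℝ) → (ι → ℝ)) (hΦQ : ∀ w, Qt (Φ w) = w) (hΦcrit : ∀ (w : κ → ℝ) (h : ι → ℝ), Qt h = 0 → S' (Φ w) h = 0)
    {D : (κ → ℝ) → (κ → ℝ) →L[ℝ] (ι → ℝ)} (hDQ : ∀ (w k : κ → ℝ), Qt (D w k) = k) (hD : ∀ w, HasFDerivAt Φ (D w) w)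
    (w : κ → ℝ) :
    HasFDerivAt (fun w' : κ → ℝ => (S' (Φ w')).comp M) ((S'' (Φ w)).bilinearComp (D w) (D w)) w := by
  have hfS : fderiv ℝ S = S' := funext fun φ => (hS φ).fderiv
  have hV2 : HasFDerivAt (fderiv ℝ S) (S'' (Φ w)) (Φ w) := by rw [hfS]; exact hS2 (Φ w)
  have hmain := hasFDerivAt_fderiv_comp_branch Qt (V := S) (s := univ) (w := w) univ_mem (fun w' _ => hD w')
    (fun w' _ => hDQ w') (fun w' _ => (hS (Φ w')).differentiableAt)
    (fun w' _ κ' hκ' => by rw [hfS]; exact hΦcrit w' κ' hκ') hV2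
  -- `fderiv (S ∘ Φ) = (S′ ∘ Φ)∘M` by the envelope theorem
  have hfW : fderiv ℝ (S ∘ Φ) = fun w' => (S' (Φ w')).comp M :=
    funext fun w' => (hasFDerivAt_fibreMin hS hfo hm Qt M hM Φ hΦQ hΦcrit w').fderiv
  rw [hfW] at hmain
  exact hmain

/-- **THE HESSIAN OF THE FIBRE MINIMUM IS FLOORED ON THE RESPONSE**: `m·Σ_x (D k x)² ≤ (S″ φ).bilinearComp D D k k`. [folklore] -/
theorem hessian_fibreMin_floor_response {S'' : (ι → ℝ) → (ι → ℝ) →L[ℝ] (ι → ℝ) →L[ℝ] ℝ}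
    (hfl : ∀ φ h : ι → ℝ, m * ∑ x, h x ^ 2 ≤ S'' φ h h) (φ : ι → ℝ) (D : (κ → ℝ) →L[ℝ] (ι → ℝ)) (k : κ → ℝ) :
    m * ∑ x, D k x ^ 2 ≤ (S'' φ).bilinearComp D D k k := by
  rw [ContinuousLinearMap.bilinearComp_apply]; exact hfl φ (D k)

/-- **… AND ON THE COARSE FIELD, MODULUS `m·vol`**: with `Qt (D k) = k`, block Jensen `vol·Σ_y (Qt h)² ≤ Σ_x h²` and `0 ≤ m`:
`m·vol·Σ_y k y² ≤ (S″ φ).bilinearComp D D k k`. [folklore] -/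
theorem hessian_fibreMin_floor {S'' : (ι → ℝ) → (ι → ℝ) →L[ℝ] (ι → ℝ) →L[ℝ] ℝ}
    (hfl : ∀ φ h : ι → ℝ, m * ∑ x, h x ^ 2 ≤ S'' φ h h) (hm : 0 ≤ m) (φ : ι → ℝ) (Qt : (ι → ℝ) →L[ℝ] (κ → ℝ))
    (D : (κ → ℝ) →L[ℝ] (ι → ℝ)) (hDQ : ∀ k : κ → ℝ, Qt (D k) = k) {vol : ℝ}
    (hJ : ∀ h : ι → ℝ, vol * ∑ y, Qt h y ^ 2 ≤ ∑ x, h x ^ 2) (k : κ → ℝ) :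
    m * vol * ∑ y, k y ^ 2 ≤ (S'' φ).bilinearComp D D k k := by
  have hJk : vol * ∑ y, k y ^ 2 ≤ ∑ x, D k x ^ 2 := by
    have h := hJ (D k)
    rwa [hDQ k] at h
  calc m * vol * ∑ y, k y ^ 2 = m * (vol * ∑ y, k y ^ 2) := by ring
    _ ≤ m * ∑ x, D k x ^ 2 := mul_le_mul_of_nonneg_left hJk hm
    _ ≤ _ := hessian_fibreMin_floor_response hfl φ D k

/-- **SECOND-ORDER STEP CLOSURE, ASSEMBLED**: the class `{HasFDerivAt S (S′ φ) φ, first-order letter m, HasFDerivAt S′ (S″ φ) φ,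
floor m}` with `m > 0`; `Qt` with right inverse `M` and block Jensen constant `vol`.  There are the fibre-critical map `Φ` (unique) and
a response family `D` with: `Qt(Φ w) = w`, `Qt(D w k) = k`, `S″(Φ w)(D w k, κ) = 0` on `ker Qt`, `HasFDerivAt Φ (D w) w`; the fibre
minimum `W = S ∘ Φ` has `HasFDerivAt W (W′ w) w` with `W′ w = (S′(Φ w))∘M`, `HasFDerivAt W′ (W″ w) w` with
`W″ w = (S″(Φ w)).bilinearComp (D w) (D w)`, the first-order letter with modulus `m·vol`, and the floor `m·vol·Σ k² ≤ W″ w k k` — the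
triple `(W, W′, W″)` is in the class `(κ, m·vol)`. [folklore] -/
theorem step_closure₂ (hS : ∀ φ, HasFDerivAt S (S' φ) φ)
    (hfo : ∀ φ ψ : ι → ℝ, S φ + S' φ (ψ - φ) + m / 2 * ∑ x, (ψ x - φ x) ^ 2 ≤ S ψ) (hm : 0 < m)
    {S'' : (ι → ℝ) → (ι → ℝ) →L[ℝ] (ι → ℝ) →L[ℝ] ℝ} (hS2 : ∀ φ, HasFDerivAt S' (S'' φ) φ)
    (hfl : ∀ φ h : ι → ℝ, m * ∑ x, h x ^ 2 ≤ S'' φ h h)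
    (Qt : (ι → ℝ) →L[ℝ] (κ → ℝ)) (M : (κ → ℝ) →L[ℝ] (ι → ℝ)) (hM : ∀ k : κ → ℝ, Qt (M k) = k) {vol : ℝ}
    (hJ : ∀ h : ι → ℝ, vol * ∑ y, Qt h y ^ 2 ≤ ∑ x, h x ^ 2) :
    ∃ (Φ : (κ → ℝ) → (ι → ℝ)) (D : (κ → ℝ) → (κ → ℝ) →L[ℝ] (ι → ℝ)),
      (∀ w, Qt (Φ w) = w) ∧ (∀ (w : κ → ℝ) (h : ι → ℝ), Qt h = 0 → S' (Φ w) h = 0) ∧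
      (∀ w, IsMinOn S {ψ | Qt ψ = w} (Φ w)) ∧
      (∀ w k, Qt (D w k) = k) ∧ (∀ (w k : κ → ℝ) (κ' : ι → ℝ), Qt κ' = 0 → S'' (Φ w) (D w k) κ' = 0) ∧
      (∀ w, HasFDerivAt Φ (D w) w) ∧
      (∀ w, HasFDerivAt (fun w' : κ → ℝ => S (Φ w')) ((S' (Φ w)).comp M) w) ∧
      (∀ w, HasFDerivAt (fun w' : κ → ℝ => (S' (Φ w')).comp M) ((S'' (Φ w)).bilinearComp (D w) (D w)) w) ∧
      (∀ w w' : κ → ℝ, S (Φ w) + ((S' (Φ w)).comp M) (w' - w) + m * vol / 2 * ∑ y, (w' y - w y) ^ 2 ≤ S (Φ w')) ∧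
      ∀ w k : κ → ℝ, m * vol * ∑ y, k y ^ 2 ≤ (S'' (Φ w)).bilinearComp (D w) (D w) k k := by
  choose Φ hΦ using fun w : κ → ℝ => (existsUnique_fibreCritical hS hfo hm Qt (M w)).1.exists
  have hΦQ : ∀ w, Qt (Φ w) = w := fun w => (hΦ w).1.trans (hM w)
  have hΦcrit : ∀ (w : κ → ℝ) (h : ι → ℝ), Qt h = 0 → S' (Φ w) h = 0 := fun w => (hΦ w).2
  choose D hD using fun w : κ → ℝ =>
    exists_hasFDerivAt_fibreCritical hS hfo hm hS2 hfl Qt M hM Φ hΦQ hΦcrit w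
  refine ⟨Φ, D, hΦQ, hΦcrit, fun w => ?_, fun w => (hD w).1, fun w => (hD w).2.1, fun w => (hD w).2.2,
    hasFDerivAt_fibreMin hS hfo hm.le Qt M hM Φ hΦQ hΦcrit,
    hasFDerivAt_gradient_fibreMin hS hfo hm.le hS2 Qt M hM Φ hΦQ hΦcrit (fun w => (hD w).1) (fun w => (hD w).2.2),
    fibreMin_firstOrder hfo hm.le Qt M hM hJ Φ hΦQ hΦcrit,
    fun w k => hessian_fibreMin_floor hfl hm.le (Φ w) Qt (D w) (hD w).1 hJ k⟩
  have := isMinOn_of_critical hfo hm.le Qt (hΦcrit w)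
  rwa [hΦQ] at this

end IFT

/-! ## §4. Toy -/

/-- Toy (§1 `existsUnique_coercive_solution` on one site with the form `H h κ = h·κ`, floor `1`, `K = ⊤`): `h = g`. -/
example (g : (Unit → ℝ) →L[ℝ] ℝ) :
    ∃! h : Unit → ℝ, h ∈ (⊤ : Submodule ℝ (Unit → ℝ)) ∧ ∀ κ' ∈ (⊤ : Submodule ℝ (Unit → ℝ)),
      ((ContinuousLinearMap.proj (R := ℝ) (φ := fun _ : Unit => ℝ) ()).smulRight
        (ContinuousLinearMap.proj (R := ℝ) (φ := fun _ : Unit => ℝ) ())) h κ' = g κ' :=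
  existsUnique_coercive_solution (ι := Unit) (m := 1) one_pos
    (fun h => by simp [ContinuousLinearMap.smulRight_apply, sq]) ⊤ g

end Summit.QuantumFields.BalabanUV.T4Continuum.NE7b.SupConvexStepHessian

end
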